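import Mathlib
import HarnessLib
import HarnessLib.Audit
import Summits.ValiantsHypothesis.ValiantsHypothesis.Theorems.LacunarySymmetroidMatrixDescartesZeroChangeRows

/-!
# ValiantsHypothesis / LacunarySymmetroid — crux `MatrixDescartes` (stmt-ValiantsHypothesis-18050, V1), LINE (A) «product_plus_one»:
# the CONCAVITY CRITERION (pen val-idea-25 g9 NOTE §56.7; Sketch-ZC-s58 `ConcavityCriterion`, `middleSum`)

NOTE §56.7 (pen val-idea-25 g9): for a company of trinomial rows `g_j = a₀ + a₁X^a + a₂X^c` (`row`, module `…ZeroChangeRows`) and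
`Φ = ∏ g_j`, at a positive critical point `t` of `Φ` which is not a root and where the middle-letter Pick sum
`M(t) = Σ_j a_{j1} t^a / g_j(t)` (`middleSum`, the Sketch's text) is positive, `|Φ|` has a STRICT LOCAL MAXIMUM: `Φ(t)·Φ″(t) < 0`
(`concavityCriterion` = the Sketch's `ConcavityCriterion` body VERBATIM).  Proof (the NOTE's, in the `t`-picture): with
`D = t·d/dt`, `Dg_j = a·a₁t^a + c·a₂t^c`, `D²g_j = a²·a₁t^a + c²·a₂t^c`, and `S = Σ_j g_j′/g_j` one has `Φ′ = Φ·S` near `t`, hence at a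
critical point `Φ″ = Φ·S′` and `t²S′ = Σ_j (g_jD²g_j − (Dg_j)²)/g_j² − t·S = (a²M + c²T) − Σ_j (Dg_j/g_j)²` with `aM + cT = t·S = 0`, so
`t²S′ = −a(c−a)M − Σ_j (Dg_j/g_j)² < 0`.

HONEST FRAMING: an exact free-standing lemma about critical points of row products (the `t`-picture form of «one critical point per
chamber»); it is NOT P6 / `OneRowZeroChange k` / the floor law; no stub of LINE (A) is touched (A40 unchanged, sorries 4 → 4);
`MatrixDescartes` OPEN; `VP ≠ VNP` is NOT proved and nothing here bears on it.
-/

set_option linter.dupNamespace false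

namespace Summit.ValiantsHypothesis.ValiantsHypothesis.Theorems.LacunarySymmetroidMatrixDescartes

namespace ZeroChange

open Polynomial Finset

noncomputable section

/-- Middle-letter Pick sum `M(t) = Σ_j a_{j1} t^a / g_j(t)` of a company (rows as coefficient triples).  (pen g9 Sketch text) -/
def middleSum {m : ℕ} (a c : ℕ) (co : Fin m → ℝ × ℝ × ℝ) (t : ℝ) : ℝ :=
  ∑ j, (co j).2.1 * t ^ a / (row a c (co j).1 (co j).2.1 (co j).2.2).eval t

/-! ## Evaluations of a row and of `t·g′`, `t²·g″` -/

/-- `g(t) = a₀ + a₁t^a + a₂t^c`. -/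
theorem eval_row (a c : ℕ) (a₀ a₁ a₂ t : ℝ) : (row a c a₀ a₁ a₂).eval t = a₀ + a₁ * t ^ a + a₂ * t ^ c := by
  simp [row]

/-- `t·g′(t) = a·a₁t^a + c·a₂t^c` (the Euler operator `D = t·d/dt`). -/
theorem mul_eval_derivative_row (a c : ℕ) (a₀ a₁ a₂ t : ℝ) :
    t * (derivative (row a c a₀ a₁ a₂)).eval t = (a : ℝ) * a₁ * t ^ a + (c : ℝ) * a₂ * t ^ c := by
  have key : ∀ (n : ℕ) (b : ℝ), t * (derivative (C b * X ^ n)).eval t = (n : ℝ) * b * t ^ n := by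
    intro n b
    rcases Nat.eq_zero_or_pos n with rfl | hn
    · simp
    · obtain ⟨n', rfl⟩ : ∃ n', n = n' + 1 := ⟨n - 1, by omega⟩
      simp only [derivative_mul, derivative_C, zero_mul, derivative_X_pow, Nat.cast_add, Nat.cast_one, Nat.add_sub_cancel,
        zero_add, eval_mul, eval_C, eval_pow, eval_X]
      ring
  rw [row, derivative_add, derivative_add, derivative_C, eval_add, eval_add, eval_zero, zero_add, mul_add, key, key]

/-- `t²·g″(t) = (a² − a)·a₁t^a + (c² − c)·a₂t^c` (`= D²g − Dg`). -/
theorem sq_mul_eval_derivative2_row (a c : ℕ) (a₀ a₁ a₂ t : ℝ) :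
    t ^ 2 * (derivative (derivative (row a c a₀ a₁ a₂))).eval t =
      ((a : ℝ) ^ 2 - a) * a₁ * t ^ a + ((c : ℝ) ^ 2 - c) * a₂ * t ^ c := by
  have key : ∀ (n : ℕ) (b : ℝ), t ^ 2 * (derivative (derivative (C b * X ^ n))).eval t = ((n : ℝ) ^ 2 - n) * b * t ^ n := by
    intro n b
    rcases Nat.eq_zero_or_pos n with rfl | hn
    · simp
    · obtain ⟨n', rfl⟩ : ∃ n', n = n' + 1 := ⟨n - 1, by omega⟩
      rcases Nat.eq_zero_or_pos n' with rfl | hn'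
      · simp
      · obtain ⟨n'', rfl⟩ : ∃ n'', n' = n'' + 1 := ⟨n' - 1, by omega⟩
        simp only [derivative_mul, derivative_C, zero_mul, derivative_X_pow, Nat.cast_add, Nat.cast_one, Nat.add_sub_cancel,
          zero_add, eval_mul, eval_C, eval_pow, eval_X, eval_add, eval_natCast, eval_one, map_add, map_one, map_natCast,
          derivative_one, derivative_natCast, add_zero]
        ring
  simp only [row, derivative_add, derivative_C, zero_add, eval_add, mul_add]
  rw [key, key]

/-! ## The criterion -/

/-- **CONCAVITY CRITERION (NOTE §56.7) — the pen g9 Sketch's `ConcavityCriterion`, VERBATIM**: at a positive critical point `t` of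
`Φ = ∏_j g_j` which is not a root of `Φ` and where the middle-letter sum is positive, `Φ(t)·Φ″(t) < 0` (strict local maximum of `|Φ|`). -/
theorem concavityCriterion : ∀ (m a c : ℕ), 0 < a → a < c → ∀ (co : Fin m → ℝ × ℝ × ℝ), (∀ j, (co j).2.2 ≠ 0) →
    ∀ t : ℝ, 0 < t →
      let Φ : ℝ[X] := ∏ j, row a c (co j).1 (co j).2.1 (co j).2.2
      Φ.eval t ≠ 0 → (derivative Φ).eval t = 0 → 0 < middleSum a c co t →
        Φ.eval t * (derivative (derivative Φ)).eval t < 0 := by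
  intro m a c ha hac co _ t ht Φ hΦ hcrit hM
  classical
  -- the rows as real functions
  set g : Fin m → ℝ[X] := fun j => row a c (co j).1 (co j).2.1 (co j).2.2 with hg
  have hΦdef : Φ = ∏ j, g j := rfl
  have hgt : ∀ j, (g j).eval t ≠ 0 := by
    intro j h0
    apply hΦ
    rw [hΦdef, eval_prod]
    exact prod_eq_zero (mem_univ j) h0
  -- S(x) = Σ_j g_j′(x)/g_j(x)
  set S : ℝ → ℝ := fun x => ∑ j, (derivative (g j)).eval x / (g j).eval x with hS
  -- near t every g_j is nonzero, and there Φ′ = Φ·S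
  have hnear : ∀ᶠ x in nhds t, ∀ j, (g j).eval x ≠ 0 := by
    rw [Filter.eventually_all]
    intro j
    exact ((g j).continuous_aeval.continuousAt (x := t)).eventually_ne (hgt j)
  have hprod : ∀ x, (∀ j, (g j).eval x ≠ 0) → (derivative Φ).eval x = Φ.eval x * S x := by
    intro x hx
    rw [hΦdef, derivative_prod_finset, eval_finsetSum, eval_prod, hS, mul_sum]
    refine sum_congr rfl fun j _ => ?_
    rw [eval_mul, eval_prod, ← mul_prod_erase univ (fun i => (g i).eval x) (mem_univ j)]
    field_simp [hx j]
  -- derivative of S at t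
  have hSderiv : HasDerivAt S
      (∑ j, ((derivative (derivative (g j))).eval t * (g j).eval t -
        (derivative (g j)).eval t * (derivative (g j)).eval t) / (g j).eval t ^ 2) t := by
    rw [hS]
    refine HasDerivAt.fun_sum fun j _ => ?_
    exact ((derivative (g j)).hasDerivAt t).fun_div ((g j).hasDerivAt t) (hgt j)
  set S' : ℝ := ∑ j, ((derivative (derivative (g j))).eval t * (g j).eval t -
      (derivative (g j)).eval t * (derivative (g j)).eval t) / (g j).eval t ^ 2 with hS'
  -- Φ″(t) = Φ′(t)·S(t) + Φ(t)·S′(t)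
  have hΦ'' : (derivative (derivative Φ)).eval t = (derivative Φ).eval t * S t + Φ.eval t * S' := by
    have h1 : HasDerivAt (fun x => (derivative Φ).eval x) ((derivative (derivative Φ)).eval t) t :=
      (derivative Φ).hasDerivAt t
    have h2 : HasDerivAt (fun x => Φ.eval x * S x) ((derivative Φ).eval t * S t + Φ.eval t * S') t :=
      (Φ.hasDerivAt t).fun_mul hSderiv
    have heq : (fun x => (derivative Φ).eval x) =ᶠ[nhds t] fun x => Φ.eval x * S x :=
      hnear.mono fun x hx => hprod x hx
    exact (h1.congr_of_eventuallyEq heq.symm).unique h2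
  -- at the critical point: S(t) = 0 and Φ″ = Φ·S′
  have hSt : S t = 0 := by
    have := hprod t hgt
    rw [hcrit] at this
    exact (mul_eq_zero.1 this.symm).resolve_left hΦ
  rw [hΦ'', hcrit, zero_mul, zero_add, ← mul_assoc]
  -- it remains to show S′ < 0
  suffices hS'neg : S' < 0 by nlinarith [mul_self_pos.2 hΦ]
  -- per-row data: G = g(t), P = t g′(t) = a a₁ t^a + c a₂ t^c, Q = t² g″(t) = (a²−a) a₁ t^a + (c²−c) a₂ t^c
  have hP : ∀ j, t * (derivative (g j)).eval t = (a : ℝ) * (co j).2.1 * t ^ a + (c : ℝ) * (co j).2.2 * t ^ c :=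
    fun j => mul_eval_derivative_row a c _ _ _ t
  have hQ : ∀ j, t ^ 2 * (derivative (derivative (g j))).eval t =
      ((a : ℝ) ^ 2 - a) * (co j).2.1 * t ^ a + ((c : ℝ) ^ 2 - c) * (co j).2.2 * t ^ c :=
    fun j => sq_mul_eval_derivative2_row a c _ _ _ t
  -- the two Pick sums M and T, with a·M + c·T = t·S(t) = 0
  set M : ℝ := ∑ j, (co j).2.1 * t ^ a / (g j).eval t with hMdef
  set T : ℝ := ∑ j, (co j).2.2 * t ^ c / (g j).eval t with hTdef
  have hM' : 0 < M := hM
  have hrel : (a : ℝ) * M + c * T = 0 := by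
    have e1 : (a : ℝ) * M + c * T = ∑ j, ((a : ℝ) * (co j).2.1 * t ^ a + (c : ℝ) * (co j).2.2 * t ^ c) / (g j).eval t := by
      rw [hMdef, hTdef, mul_sum, mul_sum, ← sum_add_distrib]
      refine sum_congr rfl fun j _ => ?_
      ring
    have e2 : ∑ j, ((a : ℝ) * (co j).2.1 * t ^ a + (c : ℝ) * (co j).2.2 * t ^ c) / (g j).eval t = t * S t := by
      rw [hS, mul_sum]
      refine sum_congr rfl fun j _ => ?_
      rw [← hP j, mul_div_assoc]
    rw [e1, e2, hSt, mul_zero]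
  -- t²·S′ = (a²M + c²T) − (aM + cT)·? … : compute t² S′ = Σ (G·Q − P² − G·P... ) / G²
  have step1 : t ^ 2 * S' = ∑ j, (t ^ 2 * (derivative (derivative (g j))).eval t / (g j).eval t -
      (t * (derivative (g j)).eval t / (g j).eval t) ^ 2) := by
    rw [hS', mul_sum]
    refine sum_congr rfl fun j _ => ?_
    have := hgt j
    field_simp
  have step2 : ∑ j, (t ^ 2 * (derivative (derivative (g j))).eval t / (g j).eval t -
      (t * (derivative (g j)).eval t / (g j).eval t) ^ 2) =
      (∑ j, (((a : ℝ) ^ 2 - a) * (co j).2.1 * t ^ a + ((c : ℝ) ^ 2 - c) * (co j).2.2 * t ^ c) / (g j).eval t) -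
      ∑ j, (t * (derivative (g j)).eval t / (g j).eval t) ^ 2 := by
    rw [← sum_sub_distrib]
    refine sum_congr rfl fun j _ => ?_
    rw [hQ j]
  have step3 : ∑ j, (((a : ℝ) ^ 2 - a) * (co j).2.1 * t ^ a + ((c : ℝ) ^ 2 - c) * (co j).2.2 * t ^ c) / (g j).eval t =
      ((a : ℝ) ^ 2 * M + (c : ℝ) ^ 2 * T) - ((a : ℝ) * M + c * T) := by
    rw [hMdef, hTdef, mul_sum, mul_sum, mul_sum, mul_sum, ← sum_add_distrib, ← sum_add_distrib, ← sum_sub_distrib]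
    refine sum_congr rfl fun j _ => ?_
    ring
  have hS'eq : t ^ 2 * S' = ((a : ℝ) ^ 2 * M + (c : ℝ) ^ 2 * T) - ((a : ℝ) * M + c * T) -
      ∑ j, (t * (derivative (g j)).eval t / (g j).eval t) ^ 2 := by
    rw [step1, step2, step3]
  have hsq : 0 ≤ ∑ j, (t * (derivative (g j)).eval t / (g j).eval t) ^ 2 := sum_nonneg fun j _ => sq_nonneg _
  have hT : (c : ℝ) * T = -(a * M) := by linarith
  have hac' : (a : ℝ) < c := by exact_mod_cast hac
  have ha' : (0 : ℝ) < a := by exact_mod_cast ha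
  have hmain : (a : ℝ) ^ 2 * M + (c : ℝ) ^ 2 * T < 0 := by
    have e : (a : ℝ) ^ 2 * M + (c : ℝ) ^ 2 * T = a * M * (a - c) := by
      rw [show (c : ℝ) ^ 2 * T = c * (c * T) by ring, hT]; ring
    rw [e]
    exact mul_neg_of_pos_of_neg (mul_pos ha' hM') (by linarith)
  have ht2 : 0 < t ^ 2 := by positivity
  by_contra hge
  push Not at hge
  have h0 : 0 ≤ t ^ 2 * S' := mul_nonneg ht2.le hge
  rw [hS'eq, hrel] at h0
  linarith

end

end ZeroChange

end Summit.ValiantsHypothesis.ValiantsHypothesis.Theorems.LacunarySymmetroidMatrixDescartes
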